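import Summits.BirchSwinnertonDyer.Rank1Residual.X11a.MainConjectureThreeHeightFree
import Literature.NumberTheory.EllipticCurves.Wuthrich2014.ThreeAdicImageSupersingularProofs
import HarnessLib

/-!
# X11a, sub-cell `CellThree` (`p = 3`, multiplicative `3`, `ρ̄_{E,3}` onto): the main-conjecture
# theorems WITHOUT the binder `h20` (Wuthrich's Lemma 20 is a tree theorem)

HONEST FRAMING (cell `b2b-bsdres`, run/shared/lean/b2b/bsd-rank1-residual/, verbatim in every
file): the goal of the cell is to DELETE the COMBINATION-SHAPED residual classes of the
Birch–Swinnerton-Dyer formula for ALL analytic-rank `≤ 1` elliptic curves over `ℚ` — "full BSD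
formula for every rank `≤ 1` curve in class `C`" assembled STRICTLY from published theorems — so
that the rank-`≤ 1` remainder becomes exactly the CONSTRUCTION-SHAPED classes, which are TYPED
(missing-input `Prop`s), NOT attempted. This is not "finishing BSD". Team n1011 (N10 / N11), seat
p05, OWNERS row T-b1ss = the `hL20`-BINDER SWEEP: Wuthrich's Lemma 20 (registry A9, the named fact
`Wuthrich2014.lemma20_surjective_threeAdic_of_semistable`: at a prime-to-`9` conductor, `ρ̄_{E,3}`
onto ⟹ `ρ̄_{E,3ⁿ}` onto for all `n`) is a tree THEOREM since 2026-08-21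
(`Wuthrich2014.lemma20_surjective_threeAdic_of_semistable_holds`, file
`Literature/NumberTheory/EllipticCurves/Wuthrich2014/ThreeAdicImageSupersingularProofs.lean`, units
lit-kato / n1011-p02), so every theorem of the cell carrying it as a hypothesis has a twin WITHOUT that
binder.  This file states those twins for the theorems of its sibling (suffix `_noL20`; statement =
the sibling's statement with the binder deleted; proof = the sibling's theorem fed with `_holds`).
No claim beyond the stated classes; labels UNCHANGED; nothing is booked.  Theorems only (no
definition, no named fact minted).

## What this file proves

Binder-free twins of `CellThree.surjective_pow_of_surj`, `CellThree.mazurMainConjectureAt_iff_bsdp_of_surj`,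
`CellThree.mazurMainConjectureAt_of_surj_of_shaAnUnit` (`X11a/MainConjectureThree.lean`) and of
`CellThree.mazurMainConjectureAt_iff_bsdp_of_surj_heightFree`,
`CellThree.mazurMainConjectureAt_of_surj_of_shaAnUnit_heightFree` (`X11a/MainConjectureThreeHeightFree.lean`):
statement = the original with `(h20 : lemma20_surjective_threeAdic_of_semistable)` deleted.

References: [Wuthrich2014] C. Wuthrich, Doc. Math. 19 (2014), Lemma 20 (p. 399), Prop. 21;
[GreenbergLNM1716] R. Greenberg, LNM 1716, §4–§5.
-/

noncomputable section

open scoped Classical MatrixGroups ModularForm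

open CongruenceSubgroup WeierstrassCurve Literature.NumberTheory.EllipticCurves
  Literature.NumberTheory.EllipticCurves.ModularForms
  Literature.NumberTheory.EllipticCurves.Rank1Residual
  Literature.NumberTheory.EllipticCurves.Rank1Residual.Typed
  Literature.NumberTheory.EllipticCurves.Wuthrich2014
  Literature.NumberTheory.EllipticCurves.SteinWuthrich2013

namespace Summit.BirchSwinnertonDyer.Rank1Residual.X11a

variable {W : WeierstrassCurve ℚ} [W.IsElliptic] [W.IsGloballyMinimal] {p : ℕ} [Fact p.Prime]

/-- **Binder-free twin of `CellThree.surjective_pow_of_surj`**: the same statement WITHOUT the hypothesis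
`Wuthrich2014.lemma20_surjective_threeAdic_of_semistable` (now the tree theorem `…_holds`).
[cite: Wuthrich2014, Lemma 20 (p. 399)] -/
theorem CellThree.surjective_pow_of_surj_noL20
    (h : CellThree W p) (hsurj : Surj W p) : ∀ n : ℕ, W.HasSurjectiveModNGaloisRep (p ^ n : ℕ) :=
  CellThree.surjective_pow_of_surj Wuthrich2014.lemma20_surjective_threeAdic_of_semistable_holds h hsurj

/-- **Binder-free twin of `CellThree.mazurMainConjectureAt_iff_bsdp_of_surj`**: the same statement WITHOUT the hypothesis
`Wuthrich2014.lemma20_surjective_threeAdic_of_semistable` (now the tree theorem `…_holds`).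
[cite: GreenbergLNM1716, §4 (PDF pp. 112–113) and §5 (closing examples)]
[cite: Wuthrich2014, Lemma 20 (p. 399)] -/
theorem CellThree.mazurMainConjectureAt_iff_bsdp_of_surj_noL20
    (hKato : kato_charIdeal_dvd_multiplicative_of_surjective)
    (hJs : thm61_splitMultiplicative) (hJn : thm61_nonsplitMultiplicative)
    (hHs : exists_isSplitMultCanonical) (hHn : exists_isMultCanonical)
    (hGZK : rank_eq_analyticRank_of_analyticRank_le_one) (hmod : hasEntireLFunction_rat)
    (hpar : nonempty_modularParametrizationData)
    (hGS : greenberg_stevens (W := W) (p := p)) (h : CellThree W p) (hsurj : Surj W p) :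
    X2.MazurMainConjectureAt W p ↔ BSDp W p :=
  CellThree.mazurMainConjectureAt_iff_bsdp_of_surj hKato Wuthrich2014.lemma20_surjective_threeAdic_of_semistable_holds
    hJs hJn hHs hHn hGZK hmod hpar hGS h hsurj

/-- **Binder-free twin of `CellThree.mazurMainConjectureAt_of_surj_of_shaAnUnit`**: the same statement WITHOUT the hypothesis
`Wuthrich2014.lemma20_surjective_threeAdic_of_semistable` (now the tree theorem `…_holds`).
[cite: Wuthrich2014, Prop. 21 (p. 400)] [cite: GreenbergLNM1716, §4 (PDF pp. 112–113) and §5 (closing examples)]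
[cite: Wuthrich2014, Lemma 20 (p. 399)] -/
theorem CellThree.mazurMainConjectureAt_of_surj_of_shaAnUnit_noL20
    (hKato : kato_charIdeal_dvd_multiplicative_of_surjective)
    (hWu : sha_dvd_analyticSha)
    (hJs : thm61_splitMultiplicative) (hJn : thm61_nonsplitMultiplicative)
    (hHs : exists_isSplitMultCanonical) (hHn : exists_isMultCanonical)
    (hGZK : rank_eq_analyticRank_of_analyticRank_le_one) (hmod : hasEntireLFunction_rat)
    (hGS : greenberg_stevens (W := W) (p := p)) (h : CellThree W p) (hsurj : Surj W p)
    (hunit : ShaAnUnit W p) : X2.MazurMainConjectureAt W p :=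
  CellThree.mazurMainConjectureAt_of_surj_of_shaAnUnit hKato Wuthrich2014.lemma20_surjective_threeAdic_of_semistable_holds
    hWu hJs hJn hHs hHn hGZK hmod hGS h hsurj hunit

/-- **Binder-free twin of `CellThree.mazurMainConjectureAt_iff_bsdp_of_surj_heightFree`**: the same statement WITHOUT the hypothesis
`Wuthrich2014.lemma20_surjective_threeAdic_of_semistable` (now the tree theorem `…_holds`).
[cite: GreenbergLNM1716, §4 (PDF pp. 112–113) and §5 (closing examples)]
[cite: Wuthrich2014, Lemma 20 (p. 399)] -/
theorem CellThree.mazurMainConjectureAt_iff_bsdp_of_surj_heightFree_noL20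
    (hKato : kato_charIdeal_dvd_multiplicative_of_surjective)
    (hJs : thm61_splitMultiplicative) (hJn : thm61_nonsplitMultiplicative)
    (hGZK : rank_eq_analyticRank_of_analyticRank_le_one) (hmod : hasEntireLFunction_rat)
    (hpar : nonempty_modularParametrizationData)
    (hGS : greenberg_stevens (W := W) (p := p)) (h : CellThree W p) (hsurj : Surj W p) :
    X2.MazurMainConjectureAt W p ↔ BSDp W p :=
  CellThree.mazurMainConjectureAt_iff_bsdp_of_surj_heightFree hKato Wuthrich2014.lemma20_surjective_threeAdic_of_semistable_holds
    hJs hJn hGZK hmod hpar hGS h hsurj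

/-- **Binder-free twin of `CellThree.mazurMainConjectureAt_of_surj_of_shaAnUnit_heightFree`**: the same statement WITHOUT the hypothesis
`Wuthrich2014.lemma20_surjective_threeAdic_of_semistable` (now the tree theorem `…_holds`).
[cite: Wuthrich2014, Prop. 21 (p. 400)] [cite: GreenbergLNM1716, §4 (PDF pp. 112–113) and §5 (closing examples)]
[cite: Wuthrich2014, Lemma 20 (p. 399)] -/
theorem CellThree.mazurMainConjectureAt_of_surj_of_shaAnUnit_heightFree_noL20
    (hKato : kato_charIdeal_dvd_multiplicative_of_surjective)
    (hWu : sha_dvd_analyticSha)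
    (hJs : thm61_splitMultiplicative) (hJn : thm61_nonsplitMultiplicative)
    (hGZK : rank_eq_analyticRank_of_analyticRank_le_one) (hmod : hasEntireLFunction_rat)
    (hGS : greenberg_stevens (W := W) (p := p)) (h : CellThree W p) (hsurj : Surj W p)
    (hunit : ShaAnUnit W p) : X2.MazurMainConjectureAt W p :=
  CellThree.mazurMainConjectureAt_of_surj_of_shaAnUnit_heightFree hKato Wuthrich2014.lemma20_surjective_threeAdic_of_semistable_holds
    hWu hJs hJn hGZK hmod hGS h hsurj hunit

end Summit.BirchSwinnertonDyer.Rank1Residual.X11a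

end
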